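/-
Copyright (c) 2026 the pub-hodgecm-mathlib formalisation cell (harness21).  Prover seat hodgecm-mathlib-K2E4-p23 (g0) (E4 base on loan to ENGINE E1), Track B ∕ K2-LIT,
h413 = `stmt-HodgeConjecture-24833`, campaign «EIS-R7-BL-SPH-3» (the `U(2,1)` clone of BL-SPH-2), brick (Ξ₂)₃ ∕ P7-B₃ (dealer K2E1-plan (g5) DEAL 2026-09-04T09:08:16Z «then → (Ξ₂)₃ ∕ P7-B₃ —
first P7 clone file of BL-SPH-3»): the constant term of the spherical Eisenstein section of `U(2,1)_{L∕L⁺}` in Bernstein–Lapid's (Ξ₂) shape, and «E ⊥ 𝒞_k» at the CM pairs with the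
quadratic datum DISCHARGED.
-/
import Summits.HodgeConjecture.HodgeConjecture.Theorems.K2E1BLEisensteinInWeightedSpaceU2Weights   -- ★ p858854 (this seat) P7 FILE C: «E ⊥ 𝒞_k» on the leaf of record, `_borel_two∕_three`
import Summits.HodgeConjecture.HodgeConjecture.Theorems.K2E1SphericalEisensteinContinuationU3Final   -- ★ (K2E4-p14 g6): `borelConstantTerm_sphericalEisenstein_cm_three` :82 (`E_B = φ₀(H^z + c(z)H^{2−z})`)
import HarnessLib

/-!
# K2·E1 — `K2E1BLEisensteinInWeightedSpaceU3` («EIS-R7-BL-SPH-3», (Ξ₂)₃ ∕ P7-B₃): (Ξ₂) for the spherical Eisenstein series of `U(2,1)_{L∕L⁺}` and «E ⊥ 𝒞_k» at the CM pairs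

Track B ∕ K2-LIT, crux h413 = `stmt-HodgeConjecture-24833`, route of record `HCCMUnconditional`; cell `hodgecm-mathlib`, squad K2, ENGINE E1, campaign «EIS-R7-BL-SPH-3» = the `N = 3` clone of
«EIS-R7-BL-SPH-2» ((ζ′) WIRING 7d1cceb628a30de8 §4 clone discipline: `2ρ_H = 1 ↦ 2`, `α₂ ↦ (H^z − H^{2−z})∕(2z−2)`; RULING «RE-WIRE N=3» 08:31:45Z; DEAL 09:08:16Z).  Prover seat
`hodgecm-mathlib-K2E4-p23` (g0).  THEOREMS ONLY (no `def`, no `instance`, no notation, no named-fact hypothesis, no `sorry`); lane `--supports stmt-HodgeConjecture-24833 --as helper`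
(count-neutral).  Closes no socket.

* §1 **(Ξ₂)₃** `exists_borelConstantTerm_sphericalEisenstein_sub_eq_mul_cm_three`: for `Re z > 2` (the Godement range at `N = 3`, `2ρ_H = 2`) there is `b ∈ ℂ` with
  `(E(φ₀H^z))_B(g) − φ₀·H(g)^z = b·H(g)^{2−z}` for every `g` (★ :82 `borelConstantTerm_sphericalEisenstein_cm_three`, `b = φ₀·(ν𝓕)⁻¹·∫ H(w₀v)^z dν`) — the `N = 3` twin of ★ FILE B §4.
* §2 **«E ⊥ 𝒞_k» AT THE CM PAIRS, QUADRATIC DATUM DISCHARGED**: `c := complexConj L` has `c² = 1` (Mathlib `IsCMField.complexConj_apply_apply`, inlined — the named lemma is ★ `RecordSystemConj.complexConj_mul_self` elsewhere in the summit) and `c ≠ 1` (`IsCMField.complexConj_ne_one`), so ★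
  FILE C's `_borel_three` ∕ `_borel_two` read **`integral_quotFun_eisensteinSeriesU_mul_conj_eq_zero_of_mem_cuspTestClass_cm_three`** ∕ **`…_cm_two`** with only the honest letters left
  (`νN`, `𝓕`, the section `f`, `φ ∈ cuspTestClass`, the X-side letter `hX`).
HONEST LABEL: HC_CM is proved only modulo the 7 printed citations (2 remaining named inputs: hLiu418 = `stmt-HodgeConjecture-24832`, h413 = `stmt-HodgeConjecture-24833`)
until rung 0 closes; this file asserts no named fact and closes no socket.
References: [BernsteinLapid2019] arXiv:1911.02342, §4 Claims 1–2 · [MoeglinWaldspurger1995] II.1.7–II.1.8 · [Rogawski1990] J. D. Rogawski, *Automorphic Representations of Unitary Groups in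
Three Variables* (1990), §2.1–2.2.
-/

set_option autoImplicit false
-- the mandated namespace repeats the single-problem summit's segment (`HodgeConjecture.HodgeConjecture`)
set_option linter.dupNamespace false

noncomputable section

open MeasureTheory Measure NumberField IsDedekindDomain Set MulAction
open scoped ENNReal NNReal ComplexConjugate
open Literature.MeasureTheory.Group Literature.NumberTheory
open Literature.NumberTheory.Automorphic Literature.NumberTheory.Automorphic.UnitaryGroup
open Summit.HodgeConjecture.HodgeConjecture.Cruxes.H413.K2E1BorelEisensteinU
open Summit.HodgeConjecture.HodgeConjecture.Cruxes.H413.K2E1BLEisensteinInWeightedSpaceU2Weights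
  (integral_quotFun_eisensteinSeriesU_mul_conj_eq_zero_of_mem_cuspTestClass_borel_two integral_quotFun_eisensteinSeriesU_mul_conj_eq_zero_of_mem_cuspTestClass_borel_three)
open Summit.HodgeConjecture.HodgeConjecture.Cruxes.H413.K2E1SphericalEisensteinContinuationU3Final (borelConstantTerm_sphericalEisenstein_cm_three)

namespace Summit.HodgeConjecture.HodgeConjecture.Cruxes.H413.K2E1BLEisensteinInWeightedSpaceU3

variable (L : Type) [Field L] [NumberField L] [IsCMField L]

/-! ## §1 (Ξ₂)₃: `(E(φ₀H^z))_B − φ₀·H^z ∈ ℂ·H^{2−z}` on `Re z > 2` -/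

section Xi2

variable [MeasurableSpace (quasiSplit (↥(maximalRealSubfield L)) L (IsCMField.complexConj L) 3).Adelic] [BorelSpace (quasiSplit (↥(maximalRealSubfield L)) L (IsCMField.complexConj L) 3).Adelic]

/-- **(Ξ₂) FOR THE SPHERICAL EISENSTEIN SERIES OF `U(2,1)_{L∕L⁺}`**: for `Re z > 2` there is `b ∈ ℂ` with `(E(φ₀H^z))_B(g) − φ₀·H(g)^z = b·H(g)^{2−z}` for EVERY `g` — B–L's Ξ₂ at `N = 3`
(`2ρ_H = 2`; ★ :82: `(E)_B = φ₀(H^z + (ν𝓕)⁻¹(∫ H(w₀v)^z dν)·H^{2−z})`). [cite: BernsteinLapid2019, §4 Claim 1] [cite: MoeglinWaldspurger1995, II.1.7] [cite: Rogawski1990, §2.2] -/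
theorem exists_borelConstantTerm_sphericalEisenstein_sub_eq_mul_cm_three
    (ν : Measure ↥(adelicUnipotent (↥(maximalRealSubfield L)) L (IsCMField.complexConj L) 3)) [ν.IsHaarMeasure]
    {𝓕 : Set ↥(adelicUnipotent (↥(maximalRealSubfield L)) L (IsCMField.complexConj L) 3)}
    (h𝓕N : IsFundamentalDomain ↥(rationalUnipotent (↥(maximalRealSubfield L)) L (IsCMField.complexConj L) 3) 𝓕 ν) (h𝓕c : IsCompact (closure 𝓕))
    (φ₀ : ℂ) {z : ℂ} (hz : 2 < z.re) :
    ∃ b : ℂ, ∀ g : (quasiSplit (↥(maximalRealSubfield L)) L (IsCMField.complexConj L) 3).Adelic,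
      borelConstantTerm ν 𝓕 (eisensteinSeriesU (flatSectionU (fun _ : (quasiSplit (↥(maximalRealSubfield L)) L (IsCMField.complexConj L) 3).Adelic => φ₀) z)) g -
          φ₀ * ((borelHeight g : ℝ) : ℂ) ^ z =
        b * ((borelHeight g : ℝ) : ℂ) ^ (2 - z) := by
  refine ⟨φ₀ * (((((ν 𝓕).toReal⁻¹ : ℝ)) : ℂ) * ∫ v : ↥(adelicUnipotent (↥(maximalRealSubfield L)) L (IsCMField.complexConj L) 3),
      (((borelHeight ((quasiSplit (↥(maximalRealSubfield L)) L (IsCMField.complexConj L) 3).toAdelic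
        (weylLongU ((IsCMField.complexConj L : L ≃ₐ[↥(maximalRealSubfield L)] L) : L →+* L) (rfl : (StdForm.antidiagonal 3).over L = (StdForm.antidiagonal 3).over L)) *
          (v : (quasiSplit (↥(maximalRealSubfield L)) L (IsCMField.complexConj L) 3).Adelic)) : ℝ) : ℂ) ^ z) ∂ν), fun g => ?_⟩
  rw [borelConstantTerm_sphericalEisenstein_cm_three L ν h𝓕N h𝓕c φ₀ hz g]
  ring

end Xi2

/-! ## §2 «E ⊥ 𝒞_k» at the CM pairs, the quadratic datum discharged -/

section Three

variable [MeasurableSpace (quasiSplit (↥(maximalRealSubfield L)) L (IsCMField.complexConj L) 3).Adelic] [BorelSpace (quasiSplit (↥(maximalRealSubfield L)) L (IsCMField.complexConj L) 3).Adelic]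

/-- **`U(2,1)_{L∕L⁺}`: «`E ⊥ 𝒞_k`»** on the leaf of record's cusp test class, with `c² = 1`, `c ≠ 1` discharged for `c = complexConj L` (★ FILE C `_borel_three`). [cite: BernsteinLapid2019, §4 Claim 2]
[cite: MoeglinWaldspurger1995, II.1.8] -/
theorem integral_quotFun_eisensteinSeriesU_mul_conj_eq_zero_of_mem_cuspTestClass_cm_three
    (μ : Measure (quasiSplit (↥(maximalRealSubfield L)) L (IsCMField.complexConj L) 3).automorphicQuotient)
    [(quasiSplit (↥(maximalRealSubfield L)) L (IsCMField.complexConj L) 3).IsAutomorphicMeasure μ]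
    (νG : Measure (quasiSplit (↥(maximalRealSubfield L)) L (IsCMField.complexConj L) 3).Adelic) [νG.IsHaarMeasure] [νG.IsInvInvariant]
    (νN : Measure ↥(adelicUnipotent (↥(maximalRealSubfield L)) L (IsCMField.complexConj L) 3)) [νN.IsHaarMeasure] [νN.IsInvInvariant]
    {𝓕 : Set ↥(adelicUnipotent (↥(maximalRealSubfield L)) L (IsCMField.complexConj L) 3)}
    (h𝓕 : IsFundamentalDomain ↥(rationalUnipotent (↥(maximalRealSubfield L)) L (IsCMField.complexConj L) 3) 𝓕 νN) (h𝓕₀ : νN 𝓕 ≠ 0) (h𝓕top : νN 𝓕 ≠ ∞)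
    {f : (quasiSplit (↥(maximalRealSubfield L)) L (IsCMField.complexConj L) 3).Adelic → ℂ} (hfm : Measurable f)
    (hfN : ∀ (u : ↥(adelicUnipotent (↥(maximalRealSubfield L)) L (IsCMField.complexConj L) 3)) (g : (quasiSplit (↥(maximalRealSubfield L)) L (IsCMField.complexConj L) 3).Adelic),
      f ((u : (quasiSplit (↥(maximalRealSubfield L)) L (IsCMField.complexConj L) 3).Adelic) * g) = f g)
    (hfB : ∀ b ∈ arithmeticBorel (↥(maximalRealSubfield L)) L (IsCMField.complexConj L) 3, ∀ x : (quasiSplit (↥(maximalRealSubfield L)) L (IsCMField.complexConj L) 3).Adelic,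
      f ((b : (quasiSplit (↥(maximalRealSubfield L)) L (IsCMField.complexConj L) 3).Adelic) * x) = f x)
    {k : ℕ} {φ : (quasiSplit (↥(maximalRealSubfield L)) L (IsCMField.complexConj L) 3).Adelic → ℂ}
    (hφ : φ ∈ K2E1BLBorelSpacesU2Defs.cuspTestClass (↥(maximalRealSubfield L)) L (IsCMField.complexConj L) 3 k νN 𝓕 μ) (hφm : Measurable φ)
    (hX : ∫⁻ x, (∑' q : Quotient (QuotientGroup.rightRel (arithmeticBorel (↥(maximalRealSubfield L)) L (IsCMField.complexConj L) 3)),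
        ‖f (((q.out : (quasiSplit (↥(maximalRealSubfield L)) L (IsCMField.complexConj L) 3).arithmeticSubgroup) : (quasiSplit (↥(maximalRealSubfield L)) L (IsCMField.complexConj L) 3).Adelic) *
          (Quotient.out x : (quasiSplit (↥(maximalRealSubfield L)) L (IsCMField.complexConj L) 3).Adelic)⁻¹)‖ₑ) *
          ‖(quasiSplit (↥(maximalRealSubfield L)) L (IsCMField.complexConj L) 3).quotFun φ x‖ₑ ∂μ < ∞) :
    ∫ x, (quasiSplit (↥(maximalRealSubfield L)) L (IsCMField.complexConj L) 3).quotFun (eisensteinSeriesU f) x *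
        conj ((quasiSplit (↥(maximalRealSubfield L)) L (IsCMField.complexConj L) 3).quotFun φ x) ∂μ = 0 :=
  integral_quotFun_eisensteinSeriesU_mul_conj_eq_zero_of_mem_cuspTestClass_borel_three (AlgEquiv.ext fun x => IsCMField.complexConj_apply_apply L x) (IsCMField.complexConj_ne_one L)
    μ νG νN h𝓕 h𝓕₀ h𝓕top hfm hfN hfB hφ hφm hX

end Three

section Two

variable [MeasurableSpace (quasiSplit (↥(maximalRealSubfield L)) L (IsCMField.complexConj L) 2).Adelic] [BorelSpace (quasiSplit (↥(maximalRealSubfield L)) L (IsCMField.complexConj L) 2).Adelic]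

/-- **`U(1,1)_{L∕L⁺}`: «`E ⊥ 𝒞_k`»** on the leaf of record's cusp test class, `c² = 1`, `c ≠ 1` discharged (★ FILE C `_borel_two`). [cite: BernsteinLapid2019, §4 Claim 2] [cite: MoeglinWaldspurger1995, II.1.8] -/
theorem integral_quotFun_eisensteinSeriesU_mul_conj_eq_zero_of_mem_cuspTestClass_cm_two
    (μ : Measure (quasiSplit (↥(maximalRealSubfield L)) L (IsCMField.complexConj L) 2).automorphicQuotient)
    [(quasiSplit (↥(maximalRealSubfield L)) L (IsCMField.complexConj L) 2).IsAutomorphicMeasure μ]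
    (νG : Measure (quasiSplit (↥(maximalRealSubfield L)) L (IsCMField.complexConj L) 2).Adelic) [νG.IsHaarMeasure] [νG.IsInvInvariant]
    (νN : Measure ↥(adelicUnipotent (↥(maximalRealSubfield L)) L (IsCMField.complexConj L) 2)) [νN.IsHaarMeasure] [νN.IsInvInvariant]
    {𝓕 : Set ↥(adelicUnipotent (↥(maximalRealSubfield L)) L (IsCMField.complexConj L) 2)}
    (h𝓕 : IsFundamentalDomain ↥(rationalUnipotent (↥(maximalRealSubfield L)) L (IsCMField.complexConj L) 2) 𝓕 νN) (h𝓕₀ : νN 𝓕 ≠ 0) (h𝓕top : νN 𝓕 ≠ ∞)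
    {f : (quasiSplit (↥(maximalRealSubfield L)) L (IsCMField.complexConj L) 2).Adelic → ℂ} (hfm : Measurable f)
    (hfN : ∀ (u : ↥(adelicUnipotent (↥(maximalRealSubfield L)) L (IsCMField.complexConj L) 2)) (g : (quasiSplit (↥(maximalRealSubfield L)) L (IsCMField.complexConj L) 2).Adelic),
      f ((u : (quasiSplit (↥(maximalRealSubfield L)) L (IsCMField.complexConj L) 2).Adelic) * g) = f g)
    (hfB : ∀ b ∈ arithmeticBorel (↥(maximalRealSubfield L)) L (IsCMField.complexConj L) 2, ∀ x : (quasiSplit (↥(maximalRealSubfield L)) L (IsCMField.complexConj L) 2).Adelic,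
      f ((b : (quasiSplit (↥(maximalRealSubfield L)) L (IsCMField.complexConj L) 2).Adelic) * x) = f x)
    {k : ℕ} {φ : (quasiSplit (↥(maximalRealSubfield L)) L (IsCMField.complexConj L) 2).Adelic → ℂ}
    (hφ : φ ∈ K2E1BLBorelSpacesU2Defs.cuspTestClass (↥(maximalRealSubfield L)) L (IsCMField.complexConj L) 2 k νN 𝓕 μ) (hφm : Measurable φ)
    (hX : ∫⁻ x, (∑' q : Quotient (QuotientGroup.rightRel (arithmeticBorel (↥(maximalRealSubfield L)) L (IsCMField.complexConj L) 2)),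
        ‖f (((q.out : (quasiSplit (↥(maximalRealSubfield L)) L (IsCMField.complexConj L) 2).arithmeticSubgroup) : (quasiSplit (↥(maximalRealSubfield L)) L (IsCMField.complexConj L) 2).Adelic) *
          (Quotient.out x : (quasiSplit (↥(maximalRealSubfield L)) L (IsCMField.complexConj L) 2).Adelic)⁻¹)‖ₑ) *
          ‖(quasiSplit (↥(maximalRealSubfield L)) L (IsCMField.complexConj L) 2).quotFun φ x‖ₑ ∂μ < ∞) :
    ∫ x, (quasiSplit (↥(maximalRealSubfield L)) L (IsCMField.complexConj L) 2).quotFun (eisensteinSeriesU f) x *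
        conj ((quasiSplit (↥(maximalRealSubfield L)) L (IsCMField.complexConj L) 2).quotFun φ x) ∂μ = 0 :=
  integral_quotFun_eisensteinSeriesU_mul_conj_eq_zero_of_mem_cuspTestClass_borel_two (AlgEquiv.ext fun x => IsCMField.complexConj_apply_apply L x) (IsCMField.complexConj_ne_one L)
    μ νG νN h𝓕 h𝓕₀ h𝓕top hfm hfN hfB hφ hφm hX

end Two

end Summit.HodgeConjecture.HodgeConjecture.Cruxes.H413.K2E1BLEisensteinInWeightedSpaceU3

end
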